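import Mathlib
import HarnessLib
import Literature.AlgebraicGeometry.DeterminantalHypersurfaces.HeltonVinnikovProofs
import Literature.FieldTheory.QuasiAlgClosed.Basic

/-!
# ValiantsHypothesis / PermanentalCones — `HyperbolicVPShadow` (Hanselka–Kummer transport)

Route `PermanentalCones`, item `stmt-ValiantsHypothesis-8655` (crux `HyperbolicVPShadow`), line
`birth`, stub `stub_hermitianPencil_of_hanselkaKummer`.

The Hanselka–Kummer fact (every hyperbolic quaternary cubic has a definite hermitian `3 × 3`
determinantal representation), rendered at the normalised direction `(1,0,0,0)`, is transported
to a general direction `e` with `F(e) = 1` by a linear change of variables: pick an invertible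
real `4 × 4` matrix `T` with `T e₁ = e` (`e ≠ 0` because a cubic form vanishes at `0`), apply the
hypothesis to the pull-back `p = F ∘ T` (again a hyperbolic cubic, now normalised at `e₁`), and
push the resulting hermitian pencil `y₀ I + y₁ B₁ + y₂ B₂ + y₃ B₃` forward along `S = T⁻¹`:
`A k := Σ_j S_{jk} B_j` is hermitian, `Σ_k e_k A_k = Σ_j (S e)_j B_j = B₀ = I` and
`F(v) = p(S v) = det (Σ_j (S v)_j B_j) = det (Σ_k v_k A_k)`.  This is the `Fin 4` / hermitian
analogue of `symmetric_pencil_of_laxConjecture` (tree file `HeltonVinnikovProofs`).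
-/

-- `<Problem> = <Summit>` for this single-conjunct summit (lakefile sets the same option tree-wide).
set_option linter.dupNamespace false

noncomputable section

namespace Summit.ValiantsHypothesis.ValiantsHypothesis.Theorems

open scoped Matrix

/-- A non-zero vector of `ℝ⁴` is the first column of an invertible matrix: permute the rows of
the lower-triangular matrix with first column (a permutation of) `e` and identity elsewhere.
[folklore] -/
theorem hkPencil_exists_matrix_mulVec_eq (e : Fin 4 → ℝ) (he : e ≠ 0) :
    ∃ T : Matrix (Fin 4) (Fin 4) ℝ, IsUnit T.det ∧ T *ᵥ ![1, 0, 0, 0] = e := by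
  classical
  obtain ⟨i, hi⟩ := Function.ne_iff.mp he
  replace hi : e i ≠ 0 := hi
  set σ : Equiv.Perm (Fin 4) := Equiv.swap 0 i with hσ
  set L : Matrix (Fin 4) (Fin 4) ℝ :=
    Matrix.of fun j k => if k = 0 then e (σ j) else if j = k then 1 else 0 with hL
  have hLdet : L.det = e i := by
    have htri : L.BlockTriangular OrderDual.toDual := by
      intro j k hjk
      have hjk' : j < k := OrderDual.toDual_lt_toDual.mp hjk
      have hk : k ≠ 0 := by
        rintro rfl
        exact Fin.not_lt_zero _ hjk'
      simp [hL, hk, hjk'.ne]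
    rw [Matrix.det_of_lowerTriangular L htri, Fin.prod_univ_four]
    simp [hL, hσ]
  refine ⟨L.submatrix σ id, ?_, ?_⟩
  · rw [Matrix.det_permute, hLdet, isUnit_iff_ne_zero]
    exact mul_ne_zero (Int.cast_ne_zero.mpr (Units.ne_zero _)) hi
  · funext j
    simp [Matrix.mulVec, dotProduct, Fin.sum_univ_four, hL, hσ, Equiv.swap_apply_self]

/-- Evaluation of a linear pull-back `F ∘ T` in four variables. [folklore] -/
theorem hkPencil_eval_aeval_linear (T : Matrix (Fin 4) (Fin 4) ℝ) (F : MvPolynomial (Fin 4) ℝ)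
    (y : Fin 4 → ℝ) :
    MvPolynomial.eval y (MvPolynomial.aeval
      (fun i => ∑ k : Fin 4, MvPolynomial.C (T i k) * MvPolynomial.X k) F) =
      MvPolynomial.eval (T *ᵥ y) F := by
  have hfun : (fun i => MvPolynomial.eval y
      (∑ k : Fin 4, MvPolynomial.C (T i k) * MvPolynomial.X k)) = T *ᵥ y := by
    funext i
    simp [map_sum, Matrix.mulVec, dotProduct]
  rw [Literature.AlgebraicGeometry.DeterminantalHypersurfaces.eval_aeval_mvPolynomial, hfun]

/-- **Hanselka–Kummer for a general direction.** If every hyperbolic quaternary cubic `p` with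
`p(1,0,0,0) = 1` (hyperbolic w.r.t. `(1,0,0,0)`: all `t ↦ p(w − t e₁)` have three real roots)
is `det (x₀ I + x₁ A₁ + x₂ A₂ + x₃ A₃)` with hermitian `3 × 3` matrices `Aᵢ`, then every
quaternary cubic form `F` hyperbolic w.r.t. a direction `e` with `F(e) = 1` is `det (Σ vᵢ Aᵢ)`
for a hermitian pencil with `Σ eᵢ Aᵢ = I` (linear change of variables `T e₁ = e`, pull back,
push forward along `T⁻¹`). [folklore] -/
theorem stub_hermitianPencil_of_hanselkaKummer :
    (∀ (p : MvPolynomial (Fin 4) ℝ), p.IsHomogeneous 3 →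
      MvPolynomial.eval ![1, 0, 0, 0] p = 1 →
      (∀ w : Fin 4 → ℝ, Multiset.card (MvPolynomial.aeval
          (fun i => Polynomial.C (w i) -
            Polynomial.C ((![1, 0, 0, 0] : Fin 4 → ℝ) i) * Polynomial.X)
          p).roots = 3) →
      ∃ A₁ A₂ A₃ : Matrix (Fin 3) (Fin 3) ℂ, A₁.IsHermitian ∧ A₂.IsHermitian ∧ A₃.IsHermitian ∧
        ∀ x : Fin 4 → ℝ, ((MvPolynomial.eval x p : ℝ) : ℂ) =
          ((x 0 : ℂ) • (1 : Matrix (Fin 3) (Fin 3) ℂ) + (x 1 : ℂ) • A₁ + (x 2 : ℂ) • A₂ +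
            (x 3 : ℂ) • A₃).det) →
    ∀ (F : MvPolynomial (Fin 4) ℝ) (e : Fin 4 → ℝ), F.IsHomogeneous 3 →
      MvPolynomial.eval e F = 1 →
      (∀ w : Fin 4 → ℝ, Multiset.card (MvPolynomial.aeval
          (fun i => Polynomial.C (w i) - Polynomial.C (e i) * Polynomial.X) F).roots = 3) →
      ∃ A : Fin 4 → Matrix (Fin 3) (Fin 3) ℂ, (∀ i, (A i).IsHermitian) ∧
        ∑ i, (e i : ℂ) • A i = 1 ∧
        ∀ v : Fin 4 → ℝ, ((MvPolynomial.eval v F : ℝ) : ℂ) = (∑ i, (v i : ℂ) • A i).det := by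
  classical
  intro h F e hF hFe hhyp
  -- `e ≠ 0` since a cubic form vanishes at the origin
  have he0 : e ≠ 0 := by
    intro he0
    have hzero : MvPolynomial.eval e F = 0 := by
      rw [he0, show (0 : Fin 4 → ℝ) = (0 : ℝ) • (0 : Fin 4 → ℝ) by simp, hF.eval_smul_eq]
      ring
    rw [hzero] at hFe
    exact zero_ne_one hFe
  -- an invertible `T` with `T e₁ = e`, and the pull-back `p = F ∘ T`
  obtain ⟨T, hTunit, hTe⟩ := hkPencil_exists_matrix_mulVec_eq e he0
  set ψ : Fin 4 → MvPolynomial (Fin 4) ℝ :=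
    fun i => ∑ k : Fin 4, MvPolynomial.C (T i k) * MvPolynomial.X k with hψ
  set p : MvPolynomial (Fin 4) ℝ := MvPolynomial.aeval ψ F with hp
  have hpeval : ∀ y, MvPolynomial.eval y p = MvPolynomial.eval (T *ᵥ y) F := by
    intro y
    rw [hp, hψ, hkPencil_eval_aeval_linear]
  have hphom : p.IsHomogeneous 3 := by
    have h1 : (MvPolynomial.aeval ψ F).IsHomogeneous (1 * 3) := by
      refine hF.aeval ψ fun i => ?_
      refine MvPolynomial.IsHomogeneous.sum _ _ _ fun k _ => ?_
      exact (MvPolynomial.isHomogeneous_X ℝ k).C_mul _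
    rw [one_mul] at h1
    exact h1
  have hpe : MvPolynomial.eval ![1, 0, 0, 0] p = 1 := by
    rw [hpeval, hTe, hFe]
  have hphyp : ∀ w : Fin 4 → ℝ, Multiset.card (MvPolynomial.aeval
      (fun i => Polynomial.C (w i) - Polynomial.C ((![1, 0, 0, 0] : Fin 4 → ℝ) i) * Polynomial.X)
      p).roots = 3 := by
    intro w
    have hpoly : MvPolynomial.aeval
        (fun i => Polynomial.C (w i) -
          Polynomial.C ((![1, 0, 0, 0] : Fin 4 → ℝ) i) * Polynomial.X) p =
        MvPolynomial.aeval
          (fun i => Polynomial.C ((T *ᵥ w) i) - Polynomial.C (e i) * Polynomial.X) F := by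
      refine Polynomial.funext fun t => ?_
      have h1 : (fun i => (Polynomial.C (w i) -
          Polynomial.C ((![1, 0, 0, 0] : Fin 4 → ℝ) i) * Polynomial.X).eval t) =
          w - t • ![1, 0, 0, 0] := by
        funext i
        simp only [Polynomial.eval_sub, Polynomial.eval_mul, Polynomial.eval_C, Polynomial.eval_X,
          Pi.sub_apply, Pi.smul_apply, smul_eq_mul]
        ring
      have h2 : (fun i => (Polynomial.C ((T *ᵥ w) i) -
          Polynomial.C (e i) * Polynomial.X).eval t) = T *ᵥ w - t • e := by
        funext i
        simp only [Polynomial.eval_sub, Polynomial.eval_mul, Polynomial.eval_C, Polynomial.eval_X,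
          Pi.sub_apply, Pi.smul_apply, smul_eq_mul]
        ring
      rw [Literature.FieldTheory.QuasiAlgClosed.eval_aeval_eq_eval,
        Literature.FieldTheory.QuasiAlgClosed.eval_aeval_eq_eval, hpeval, h1, h2, Matrix.mulVec_sub,
        Matrix.mulVec_smul, hTe]
    rw [hpoly]
    exact hhyp (T *ᵥ w)
  -- the Hanselka–Kummer fact for `p`
  obtain ⟨B₁, B₂, B₃, hB₁, hB₂, hB₃, hdet⟩ := h p hphom hpe hphyp
  -- back to the original coordinates with `S = T⁻¹`
  set S : Matrix (Fin 4) (Fin 4) ℝ := T⁻¹ with hS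
  have hTS : T * S = 1 := Matrix.mul_nonsing_inv T hTunit
  have hST : S * T = 1 := Matrix.nonsing_inv_mul T hTunit
  set A : Fin 4 → Matrix (Fin 3) (Fin 3) ℂ := fun k =>
    (S 0 k : ℂ) • (1 : Matrix (Fin 3) (Fin 3) ℂ) + (S 1 k : ℂ) • B₁ + (S 2 k : ℂ) • B₂ +
      (S 3 k : ℂ) • B₃ with hA
  have hsa : ∀ r : ℝ, IsSelfAdjoint (r : ℂ) := fun r => Complex.conj_ofReal r
  have hAherm : ∀ k, (A k).IsHermitian := fun k =>
    (((Matrix.isHermitian_one.smul (hsa _)).add (hB₁.smul (hsa _))).add (hB₂.smul (hsa _))).add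
      (hB₃.smul (hsa _))
  have hpencil : ∀ v : Fin 4 → ℝ, ∑ k, (v k : ℂ) • A k =
      ((S *ᵥ v) 0 : ℂ) • (1 : Matrix (Fin 3) (Fin 3) ℂ) + ((S *ᵥ v) 1 : ℂ) • B₁ +
        ((S *ᵥ v) 2 : ℂ) • B₂ + ((S *ᵥ v) 3 : ℂ) • B₃ := by
    intro v
    simp only [hA, Matrix.mulVec, dotProduct, Fin.sum_univ_four]
    push_cast
    module
  refine ⟨A, hAherm, ?_, fun v => ?_⟩
  · -- `L(e) = I` since `S e = e₁`
    have hSe : S *ᵥ e = ![1, 0, 0, 0] := by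
      rw [← hTe, Matrix.mulVec_mulVec, hST, Matrix.one_mulVec]
    rw [hpencil, hSe]
    simp
  · -- `F(v) = F(T (S v)) = p(S v) = det L(v)`
    have hv : T *ᵥ (S *ᵥ v) = v := by
      rw [Matrix.mulVec_mulVec, hTS, Matrix.one_mulVec]
    rw [hpencil, ← hdet (S *ᵥ v), hpeval, hv]

end Summit.ValiantsHypothesis.ValiantsHypothesis.Theorems
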